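import Summits.KontsevichZagierPeriods.KontsevichZagierPeriods.Theorems.PlanarSAZylev.Negative.NonVacuity
import Literature.NumberTheory.Transcendental.KZLogCalculusProofs

/-!
# `PlanarSAZylev` (crux `stmt-KontsevichZagierPeriods-9848`, route `SymplecticScissors`), line
# `reservoir-peeling`: small planar models for the negative-side analysis of its stubs (drefute seat)

Pure geometry, no route statement involved; the unit square `sq`, the coordinate half-spaces, `det_id_two`
and the rational translations `tv`/`isSemialgebraicMapOn_translate` are REUSED from the cdisprove kit in
this directory (`Negative/Kit.lean`, `Negative/NonVacuity.lean`, namespace `…PlanarSAZylevNegative`).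
New here: the rational translate `sq2 = sq + (2,0)`, the base interval `I01 ⊆ ℝ¹` and the bands `band a b` over it in
the `Fin.init`/`Fin.last` coordinates used by the skeleton's grounding stubs, the big square
`bigSq = (0,2)²`, the coordinate swap `swapCLM` (det `-1`), the open quadrant `quad` (a `ℚ`-semialgebraic coordinatewise down-set of INFINITE
area), and two NON-semialgebraic sets `irrSq = sq ∖ ratLines`, `irrBig = bigSq ∖ ratLines` (the
rational abscissae removed: positive area, EMPTY interior, so every `ℚ`-semialgebraic subset is null —
`volume_eq_zero_of_isSemialgebraic_subset_diff_ratLines`, via `KZ.volume_eq_zero_of_interior_eq_empty`).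
Consumed by `ReservoirPeelingStubMutations.lean`.
-/

set_option linter.dupNamespace false

noncomputable section

namespace Summit.KontsevichZagierPeriods.KontsevichZagierPeriods.Theorems.PlanarSAZylev.Negative

open Set MeasureTheory Function Filter Topology MvPolynomial
open scoped ENNReal
open Literature.NumberTheory.Transcendental Literature.ModelTheory.ExponentialFields
open Summit.KontsevichZagierPeriods.SymplecticScissors.PlanarSAZylevNegative

/-! ### The unit square (from the kit) and its rational translate -/

/-- The unit square is open. -/
theorem isOpen_sq : IsOpen sq := isOpen_set_pi finite_univ fun _ _ => isOpen_Ioo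

/-- The unit square is bounded. -/
theorem isBounded_sq : Bornology.IsBounded sq := Bornology.IsBounded.pi fun _ => Metric.isBounded_Ioo 0 1

/-- `tv` is compatible with negation. -/
theorem tv_neg (v : Fin 2 → ℚ) : tv (-v) = -tv v := by
  funext i; simp [tv]

/-- The translate `(2,3) × (0,1)` of the unit square by `(2, 0)`. -/
def sq2 : Set (Fin 2 → ℝ) := (fun x => x + tv ![2, 0]) '' sq

/-- `sq2` has area `1`. -/
theorem volume_sq2 : volume sq2 = 1 := by rw [sq2, volume_translate, volume_sq]

/-- `sq2` is measurable (open). -/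
theorem measurableSet_sq2 : MeasurableSet sq2 :=
  ((isOpenMap_add_right (tv ![2, 0])) sq isOpen_sq).measurableSet

/-- Points of `sq2` have abscissa `> 2`. -/
theorem two_lt_of_mem_sq2 {y : Fin 2 → ℝ} (hy : y ∈ sq2) : (2 : ℝ) < y 0 := by
  obtain ⟨x, hx, rfl⟩ := hy
  have := (mem_sq.mp hx 0).1
  simp [tv]
  linarith

/-- The unit square and its translate are disjoint. -/
theorem disjoint_sq_sq2 : Disjoint sq sq2 := by
  rw [disjoint_left]
  intro y hy hy2
  have h1 := (mem_sq.mp hy 0).2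
  have h2 := two_lt_of_mem_sq2 hy2
  linarith

/-- Together they have area `2`. -/
theorem volume_sq_union_sq2 : volume (sq ∪ sq2) = 2 := by
  rw [measure_union disjoint_sq_sq2 measurableSet_sq2, volume_sq, volume_sq2]
  norm_num

/-- The coordinate swap of the plane as a continuous linear map (matrix `!![0, 1; 1, 0]`). -/
def swapCLM : (Fin 2 → ℝ) →L[ℝ] (Fin 2 → ℝ) :=
  LinearMap.toContinuousLinearMap (Matrix.toLin' !![(0 : ℝ), 1; 1, 0])

/-- The swap exchanges the two coordinates. -/
theorem swapCLM_apply (x : Fin 2 → ℝ) : swapCLM x = ![x 1, x 0] := by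
  ext i
  fin_cases i <;> simp [swapCLM, Matrix.toLin'_apply, Matrix.mulVec, dotProduct, Fin.sum_univ_two]

/-- The swap has determinant `-1`. -/
theorem det_swapCLM : swapCLM.det = -1 := by
  rw [ContinuousLinearMap.det, swapCLM, LinearMap.coe_toContinuousLinearMap, LinearMap.det_toLin']
  simp [Matrix.det_fin_two]

/-- The swap is injective. -/
theorem swapCLM_injective : Function.Injective swapCLM := by
  intro x y h
  rw [swapCLM_apply, swapCLM_apply] at h
  ext i
  fin_cases i
  · simpa using congrFun h 1
  · simpa using congrFun h 0

/-! ### Bands over the base interval, the big square, the quadrant -/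

/-- The open unit interval of the base line `ℝ¹`. -/
def I01 : Set (Fin 1 → ℝ) := {x | 0 < x 0 ∧ x 0 < 1}

/-- `I01` is `ℚ`-semialgebraic (same statement as `…RealOnePeriodRelationsNegative.Stubs.isSemialgebraic_I01`
in another sub-tree; a local copy keeps the import light). -/
theorem isSemialgebraic_I01 : IsSemialgebraic ℚ I01 := by
  have := (isSemialgebraic_coord_gt (n := 1) 0 0).inter (isSemialgebraic_coord_lt (n := 1) 0 1)
  convert this using 1
  ext x; simp [I01]

/-- `I01` is open. -/
theorem isOpen_I01 : IsOpen I01 :=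
  (isOpen_lt continuous_const (continuous_apply 0)).inter (isOpen_lt (continuous_apply 0) continuous_const)

/-- Rational constants are `ℚ`-semialgebraic functions (on a `ℚ`-semialgebraic base). -/
theorem isSemialgebraicFunOn_ratConst {s : Set (Fin 1 → ℝ)} (hs : IsSemialgebraic ℚ s) (q : ℚ) :
    IsSemialgebraicFunOn ℚ s (fun _ => (q : ℝ)) := by
  have := isSemialgebraicFunOn_aeval hs (MvPolynomial.C q : MvPolynomial (Fin 1) ℚ)
  convert this using 2 with x
  simp

/-- The open band over `I01` between the heights `a` and `b`, written in the stubs'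
`Fin.init`/`Fin.last` coordinates. -/
def band (a b : ℝ) : Set (Fin 2 → ℝ) := {z | Fin.init z ∈ I01 ∧ a < z (Fin.last 1) ∧ z (Fin.last 1) < b}

/-- A band is a coordinate box. -/
theorem band_eq_pi (a b : ℝ) :
    band a b = Set.pi univ fun i => Ioo ((![0, a] : Fin 2 → ℝ) i) ((![1, b] : Fin 2 → ℝ) i) := by
  ext z
  simp [band, I01, Fin.init, Set.mem_pi, Fin.forall_fin_two]

/-- The area of a band is its height (for `a ≤ b`; `0` otherwise). -/
theorem volume_band (a b : ℝ) : volume (band a b) = ENNReal.ofReal (b - a) := by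
  rw [band_eq_pi, Real.volume_pi_Ioo]
  simp [Fin.prod_univ_two]

/-- The big open square `(0,2)²`. -/
def bigSq : Set (Fin 2 → ℝ) := Set.pi univ fun _ => Ioo 0 2

/-- `bigSq` is `ℚ`-semialgebraic. -/
theorem isSemialgebraic_bigSq : IsSemialgebraic ℚ bigSq := by
  have h : bigSq = ({x | ((0 : ℚ) : ℝ) < x 0} ∩ {x | x 0 < ((2 : ℚ) : ℝ)}) ∩
      ({x | ((0 : ℚ) : ℝ) < x 1} ∩ {x | x 1 < ((2 : ℚ) : ℝ)}) := by
    ext x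
    simp [bigSq, Set.mem_pi, Fin.forall_fin_two]
  rw [h]
  exact ((isSemialgebraic_coord_gt 0 0).inter (isSemialgebraic_coord_lt 0 2)).inter
    ((isSemialgebraic_coord_gt 1 0).inter (isSemialgebraic_coord_lt 1 2))

/-- `bigSq` has area `4`. -/
theorem volume_bigSq : volume bigSq = 4 := by
  have := Real.volume_pi_Ioo (a := fun _ : Fin 2 => (0 : ℝ)) (b := fun _ => 2)
  simp only [sub_zero, Finset.prod_const, Finset.card_univ, Fintype.card_fin] at this
  rw [bigSq, this, ENNReal.ofReal_ofNat]
  norm_num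

/-- `bigSq` is bounded. -/
theorem isBounded_bigSq : Bornology.IsBounded bigSq := Bornology.IsBounded.pi fun _ => Metric.isBounded_Ioo 0 2

/-- The open positive quadrant: a `ℚ`-semialgebraic coordinatewise down-set of INFINITE area. -/
def quad : Set (Fin 2 → ℝ) := {x | ∀ i, 0 < x i}

/-- `quad` is `ℚ`-semialgebraic. -/
theorem isSemialgebraic_quad : IsSemialgebraic ℚ quad := by
  have := (isSemialgebraic_coord_gt (n := 2) 0 0).inter (isSemialgebraic_coord_gt (n := 2) 1 0)
  convert this using 1
  ext x; simp [quad, Fin.forall_fin_two]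

/-- `quad` has infinite area. -/
theorem volume_quad : volume quad = ⊤ := by
  have h : quad = Set.pi univ fun _ : Fin 2 => Ioi (0 : ℝ) := by ext x; simp [quad, Set.mem_pi]
  rw [h, volume_pi_pi]
  simp

/-! ### Non-semialgebraic models: squares with the rational abscissae removed -/

/-- The points of the plane with RATIONAL abscissa: a countable union of null vertical lines. -/
def ratLines : Set (Fin 2 → ℝ) := {p | p 0 ∈ range ((↑) : ℚ → ℝ)}

/-- `ratLines` is null. -/
theorem volume_ratLines : volume ratLines = 0 := by
  have h : ratLines = ⋃ q : ℚ, {p : Fin 2 → ℝ | p 0 = (q : ℝ)} := by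
    ext p; simp [ratLines, eq_comm]
  rw [h, measure_iUnion_null_iff]
  intro q
  have := Measure.pi_hyperplane (fun _ : Fin 2 => (volume : Measure ℝ)) 0 (q : ℝ)
  rwa [← volume_pi] at this

/-- Every non-empty open planar set meets `ratLines` (rationals are dense): an open set avoiding it is
empty. -/
theorem eq_empty_of_isOpen_of_forall_not_mem_ratLines {U : Set (Fin 2 → ℝ)} (hUo : IsOpen U)
    (hU : ∀ p ∈ U, p ∉ ratLines) : U = ∅ := by
  rcases eq_empty_or_nonempty U with h | ⟨x, hx⟩
  · exact h
  exfalso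
  have hc : Continuous fun t : ℝ => Function.update x 0 t := continuous_const.update 0 continuous_id
  have hV : IsOpen ((fun t : ℝ => Function.update x 0 t) ⁻¹' U) := hUo.preimage hc
  have hxV : x 0 ∈ (fun t : ℝ => Function.update x 0 t) ⁻¹' U := by simpa using hx
  obtain ⟨ε, hε, hball⟩ := Metric.isOpen_iff.1 hV (x 0) hxV
  obtain ⟨q, hq1, hq2⟩ := exists_rat_btwn (show x 0 < x 0 + ε by linarith)
  have hqball : (q : ℝ) ∈ Metric.ball (x 0) ε := by
    rw [Metric.mem_ball, Real.dist_eq, abs_lt]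
    constructor <;> linarith
  exact hU _ (hball hqball) ⟨q, by simp⟩

/-- An open subset of `S ∖ ratLines` is empty. -/
theorem eq_empty_of_isOpen_subset_diff_ratLines {U S : Set (Fin 2 → ℝ)} (hUo : IsOpen U)
    (hU : U ⊆ S \ ratLines) : U = ∅ :=
  eq_empty_of_isOpen_of_forall_not_mem_ratLines hUo fun _ hp => (hU hp).2

/-- A `ℚ`-semialgebraic subset of `S ∖ ratLines` is NULL: it has empty interior, and semialgebraic sets
with empty interior are null (`KZ.volume_eq_zero_of_interior_eq_empty`). -/
theorem volume_eq_zero_of_isSemialgebraic_subset_diff_ratLines {W S : Set (Fin 2 → ℝ)}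
    (hW : IsSemialgebraic ℚ W) (hWS : W ⊆ S \ ratLines) : volume W = 0 :=
  KZ.volume_eq_zero_of_interior_eq_empty hW
    (eq_empty_of_isOpen_subset_diff_ratLines isOpen_interior (interior_subset.trans hWS))

/-- The unit square with the rational abscissae removed: bounded, area `1`, empty interior. -/
def irrSq : Set (Fin 2 → ℝ) := sq \ ratLines

/-- `irrSq` has area `1`. -/
theorem volume_irrSq : volume irrSq = 1 := by rw [irrSq, measure_sdiff_null volume_ratLines, volume_sq]

/-- `irrSq` is bounded. -/
theorem isBounded_irrSq : Bornology.IsBounded irrSq := isBounded_sq.subset sdiff_subset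

/-- The big square with the rational abscissae removed: bounded, area `4`, empty interior. -/
def irrBig : Set (Fin 2 → ℝ) := bigSq \ ratLines

/-- `irrBig` has area `4`. -/
theorem volume_irrBig : volume irrBig = 4 := by rw [irrBig, measure_sdiff_null volume_ratLines, volume_bigSq]

/-- `irrBig` is bounded. -/
theorem isBounded_irrBig : Bornology.IsBounded irrBig := isBounded_bigSq.subset sdiff_subset

end Summit.KontsevichZagierPeriods.KontsevichZagierPeriods.Theorems.PlanarSAZylev.Negative
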